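import Literature.NumberTheory.EllipticCurves.PAdicTwoVariableTransformSum
import Literature.NumberTheory.EllipticCurves.PAdicLFunctionInterpolationProofs
import HarnessLib

/-!
# Bounded distributions on `ℤ_p^× × ℤ_p^×` in Teichmüller–`γ` class coordinates

Every unit of `ℤ_p` is uniquely `x = η γ^σ` with `η ∈ μ_τ(ℤ_p)` a Teichmüller representative
(`τ = |μ_torsion(ℤ_p^×)|`, `p − 1` for odd `p`), `γ = 1 + p^{e₀}` the topological generator of
`1 + p^{e₀}ℤ_p` and `σ ∈ ℤ_p`; modulo `p^{n+e₀}` the classes `η γ^s`, `s mod p^n`, run over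
`(ℤ/p^{n+e₀})^×` exactly once (tree: `classMap_injective`, `card_classDomain`,
`finsum_sum_classes_eq_sum_units`, file `PAdicLFunctionInterpolationProofs.lean`; Washington §7.2).
For a bounded distribution `ν` on `ℤ_p × ℤ_p` (level data on `(ℤ/p^L)²`, `PAdicDistributionIntegral.lean`)
and a pair of Teichmüller representatives `(η₁, η₂)` we define the **class-coordinate piece**

  `classDist ν η₁ η₂`, with level-`n` data `(s, t) ↦ ν_{n+e₀}(η₁ γ^s, η₂ γ^t)`,

prove that it is again a bounded distribution on `ℤ_p × ℤ_p` (the distribution relation is the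
statement that the lifts of the unit class `η γ^s mod p^{n+e₀}` to level `p^{n+1+e₀}` are exactly the
classes `η γ^{s'}`, `s' ≡ s (mod p^n)` — `castHom_classOf`, `exists_lift_classOf`), and
assemble the **branch series**

  `branchSeries ν c = Σ_{(η₁, η₂)} η₂^c · 𝓐(classDist ν η₁ η₂)`      (`PAdicTwoVariableTransformSum`)

— for Kitagawa's measure `μ_𝐟` on `ℤ_p^× × ℤ_p^×` in the coordinates `(z, x) = (y/x, x)` this is the
`ω^c`-branch `F_c(X, Y) = ∫ ω^c(x) (1+X)^{ℓ(z)} (1+Y)^{ℓ(x)} dμ_𝐟` of the two-variable `p`-adic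
`L`-function (Delbourgo 2008, Def. 4.12 with `ψ = ω^{-c}`; Greenberg–Stevens 1993, Thm. 5.15;
Kitagawa 1994, Thm. 1.1) — together with its evaluation at `(γ^a − 1, γ^b − 1)` as a limit of sums
over `((ℤ/p^{n+e₀})^×)²`:

  `F_c(γ^a − 1, γ^b − 1) = lim_n Σ_{η₁,η₂} Σ_{s,t} ν_{n+e₀}(η₁γ^s, η₂γ^t) η₂^c γ^{as} γ^{bt}`
  `                      = "∫_{ℤ_p^× × ℤ_p^×} ω^c(x) ⟨z⟩^a ⟨x⟩^b dν(z, x)"`      (`tendsto_branchSeries`)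

and, for `τ ∣ a` and `c ≡ b (mod τ)` and `ν` supported on pairs of units, the **moment identity**

  `F_c(γ^a − 1, γ^b − 1) = ∫_{ℤ_p × ℤ_p} z^a x^b dν(z, x)`      (`padicEval₂_branchSeries_eq_integral`)

with the integral of `PAdicDistributionIntegral.lean` (the unit-class sums with representatives
`η γ^{s.val}` are Riemann sums up to the choice of representatives: `riemannSum_eq_sum_classes`,
`norm_classRepSum_sub_riemannSum_le`, `tendsto_classRepSum_integral`).  With `a = k − 2 ≡ 0 (mod p−1)`,
`b = n − 1`, `c ≡ n − 1` this is the shape `∫ x^{n-1} (y/x)^{k-2} dμ` of the interpolation formula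
(Delbourgo 2008, p. 100).

Brick B1d of the bottom-up plan recorded with the named fact
`greenbergStevens_kitagawa_twoVariable_interpolation_allBranches`.  Everything is proved; no named facts.

## References

* L. C. Washington, *Introduction to cyclotomic fields*, GTM 83, §7.2.
* B. Mazur, J. Tate, J. Teitelbaum, Invent. Math. 84 (1986), §I.13. [MazurTateTeitelbaum1986Invent]
* D. Delbourgo, *Elliptic Curves and Big Galois Representations* (2008), Thm. 4.11, Def. 4.12.
  [Delbourgo2008]
-/

noncomputable section

open Filter Topology

namespace Literature.NumberTheory.EllipticCurves

variable {p : ℕ} [Fact p.Prime]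

/-! ### The classes `η γ^s mod p^{n+e₀}` and their reductions -/

section Classes

variable (p) in
/-- The **class of `η γ^s` modulo `p^{n+e₀}`** (`η` a Teichmüller representative, `s mod p^n`), the
image of `(η, s)` under the bijection `μ_τ × ℤ/p^n → (ℤ/p^{n+e₀})^×` of the tree
(`classMap_injective`, `card_classDomain`). [folklore] -/
def classOf (n : ℕ) (η : rootsOfUnity (torsionOrder p) ℤ_[p]) (s : ZMod (p ^ n)) :
    ZMod (p ^ (n + cyclotomicExponent p)) :=
  PadicInt.toZModPow (n + cyclotomicExponent p) ((η : ℤ_[p]ˣ) : ℤ_[p]) *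
    (cyclotomicGenerator p : ZMod (p ^ (n + cyclotomicExponent p))) ^ s.val

/-- Unfolding lemma for `classOf`. [folklore] -/
theorem classOf_def (n : ℕ) (η : rootsOfUnity (torsionOrder p) ℤ_[p]) (s : ZMod (p ^ n)) :
    classOf p n η s = PadicInt.toZModPow (n + cyclotomicExponent p) ((η : ℤ_[p]ˣ) : ℤ_[p]) *
      (cyclotomicGenerator p : ZMod (p ^ (n + cyclotomicExponent p))) ^ s.val := rfl

/-- The classes are units. [folklore] -/
theorem isUnit_classOf (n : ℕ) (η : rootsOfUnity (torsionOrder p) ℤ_[p]) (s : ZMod (p ^ n)) :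
    IsUnit (classOf p n η s) :=
  isUnit_classMap p n (η, s)

/-- `(η, s) ↦ classOf n η s` is injective. [folklore] -/
theorem classOf_injective (n : ℕ) {η η' : rootsOfUnity (torsionOrder p) ℤ_[p]} {s s' : ZMod (p ^ n)}
    (h : classOf p n η s = classOf p n η' s') : η = η' ∧ s = s' := by
  have := classMap_injective p n (a₁ := (η, s)) (a₂ := (η', s')) h
  exact Prod.mk.inj this

/-- **Every unit of `ℤ/p^{n+e₀}` is a class** `η γ^s`. [folklore] -/
theorem exists_classOf_eq_of_isUnit (n : ℕ) {b : ZMod (p ^ (n + cyclotomicExponent p))} (hb : IsUnit b) :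
    ∃ (η : rootsOfUnity (torsionOrder p) ℤ_[p]) (s : ZMod (p ^ n)), classOf p n η s = b := by
  classical
  haveI := neZero_torsionOrder p
  haveI := Fintype.ofFinite (rootsOfUnity (torsionOrder p) ℤ_[p])
  set Φ : rootsOfUnity (torsionOrder p) ℤ_[p] × ZMod (p ^ n) →
      (ZMod (p ^ (n + cyclotomicExponent p)))ˣ := fun x ↦ (isUnit_classMap p n x).unit with hΦ
  have hΦinj : Function.Injective Φ := by
    intro x y hxy
    have h := congr_arg Units.val hxy
    simp only [hΦ, IsUnit.unit_spec] at h
    exact classMap_injective p n h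
  have hΦbij : Function.Bijective Φ :=
    (Fintype.bijective_iff_injective_and_card Φ).mpr ⟨hΦinj, card_classDomain p n⟩
  obtain ⟨⟨η, s⟩, hx⟩ := hΦbij.2 hb.unit
  refine ⟨η, s, ?_⟩
  have h := congr_arg Units.val hx
  simp only [hΦ, IsUnit.unit_spec] at h
  exact h

/-- **Reduction of classes**: `classOf (n+1) η s' ≡ classOf n η (s' mod p^n)` modulo `p^{n+e₀}` —
`γ` has order `p^n` modulo `p^{n+e₀}` (`orderOf_cyclotomicGenerator`). [folklore] -/
theorem castHom_classOf (n : ℕ) (η : rootsOfUnity (torsionOrder p) ℤ_[p]) (s' : ZMod (p ^ (n + 1))) :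
    ZMod.castHom (pow_dvd_pow p (by omega : n + cyclotomicExponent p ≤ n + 1 + cyclotomicExponent p))
        (ZMod (p ^ (n + cyclotomicExponent p))) (classOf p (n + 1) η s') =
      classOf p n η (ZMod.castHom (pow_dvd_pow p n.le_succ) (ZMod (p ^ n)) s') := by
  haveI : NeZero (p ^ (n + 1)) := ⟨pow_ne_zero _ (Fact.out : p.Prime).ne_zero⟩
  have hle : n + cyclotomicExponent p ≤ n + 1 + cyclotomicExponent p := by omega
  rw [classOf_def, classOf_def, map_mul, map_pow, map_natCast, ZMod.castHom_apply,
    PadicInt.cast_toZModPow _ _ hle]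
  congr 1
  -- `γ^{s'.val} = γ^{(s' mod p^n).val}` modulo `p^{n+e₀}`
  rw [ZMod.castHom_apply, ZMod.cast_eq_val, ZMod.val_natCast]
  have hord := orderOf_cyclotomicGenerator p n
  conv_lhs => rw [← pow_mod_orderOf, hord]

/-- **The lifts of a unit class are classes**: if `c mod p^{n+e₀} = classOf n η s` then
`c = classOf (n+1) η s'` for a unique `s'`, and `s' ≡ s (mod p^n)`. [folklore] -/
theorem exists_lift_classOf (n : ℕ) (η : rootsOfUnity (torsionOrder p) ℤ_[p]) (s : ZMod (p ^ n))
    {c : ZMod (p ^ (n + 1 + cyclotomicExponent p))}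
    (hc : ZMod.castHom (pow_dvd_pow p (by omega : n + cyclotomicExponent p ≤ n + 1 + cyclotomicExponent p))
      (ZMod (p ^ (n + cyclotomicExponent p))) c = classOf p n η s) :
    ∃ s' : ZMod (p ^ (n + 1)), ZMod.castHom (pow_dvd_pow p n.le_succ) (ZMod (p ^ n)) s' = s ∧
      classOf p (n + 1) η s' = c := by
  have hle : n + cyclotomicExponent p ≤ n + 1 + cyclotomicExponent p := by omega
  have h1 : 1 ≤ n + cyclotomicExponent p := by
    have := cyclotomicExponent_ne_zero p; omega
  -- `c` is a unit (it lifts a unit), hence a class at level `n + 1`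
  have hcu : IsUnit c := by
    rw [isUnit_iff_isUnit_castHom h1 hle, hc]
    exact isUnit_classOf n η s
  obtain ⟨η', s', hs'⟩ := exists_classOf_eq_of_isUnit (n + 1) hcu
  -- its reduction identifies `η' = η` and `s' mod p^n = s`
  have hred := castHom_classOf n η' s'
  rw [hs', hc] at hred
  obtain ⟨rfl, hs⟩ := classOf_injective n hred
  exact ⟨s', hs.symm, hs'⟩

/-! ### Casts between `ℤ/p^L` for propositionally equal levels -/

omit [Fact p.Prime] in
variable (p) in
/-- The canonical isomorphism `ℤ/p^L → ℤ/p^{L'}` for `L = L'` (the levels `n + e₀` of the class map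
and `e₀ + n` of the class-coordinate tower differ only propositionally). [folklore] -/
def levelCast {L L' : ℕ} (h : L = L') : ZMod (p ^ L) →+* ZMod (p ^ L') :=
  ZMod.castHom (pow_dvd_pow p h.ge) (ZMod (p ^ L'))

omit [Fact p.Prime] in
/-- `levelCast` along `rfl` is the identity. [folklore] -/
theorem levelCast_rfl {L : ℕ} (x : ZMod (p ^ L)) : levelCast p (rfl : L = L) x = x := by
  rw [levelCast, ZMod.castHom_apply, ZMod.cast_id]

omit [Fact p.Prime] in
/-- Composition of level casts. [folklore] -/
theorem levelCast_levelCast {L L' L'' : ℕ} (h : L = L') (h' : L' = L'') (x : ZMod (p ^ L)) :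
    levelCast p h' (levelCast p h x) = levelCast p (h.trans h') x :=
  RingHom.congr_fun (Subsingleton.elim ((levelCast p h').comp (levelCast p h)) (levelCast p (h.trans h'))) x

omit [Fact p.Prime] in
/-- `levelCast h.symm ∘ levelCast h = id`. [folklore] -/
theorem levelCast_symm_levelCast {L L' : ℕ} (h : L = L') (x : ZMod (p ^ L)) :
    levelCast p h.symm (levelCast p h x) = x := by
  rw [levelCast_levelCast]; exact levelCast_rfl x

omit [Fact p.Prime] in
/-- `levelCast` is injective. [folklore] -/
theorem levelCast_injective {L L' : ℕ} (h : L = L') : Function.Injective (levelCast p h) :=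
  fun x y hxy => by simpa only [levelCast_symm_levelCast] using congr_arg (levelCast p h.symm) hxy

omit [Fact p.Prime] in
/-- **Reductions commute with level casts**: any two ring homomorphisms `ℤ/p^L → ℤ/p^m` agree
(`ZMod.subsingleton_ringHom`); in particular `castHom ∘ levelCast = castHom`. [folklore] -/
theorem castHom_levelCast {L L' m : ℕ} (h : L = L') (hm' : m ≤ L') (hm : m ≤ L) (x : ZMod (p ^ L)) :
    ZMod.castHom (pow_dvd_pow p hm') (ZMod (p ^ m)) (levelCast p h x) =
      ZMod.castHom (pow_dvd_pow p hm) (ZMod (p ^ m)) x := by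
  have hcomp : (ZMod.castHom (pow_dvd_pow p hm') (ZMod (p ^ m))).comp (levelCast p h) =
      ZMod.castHom (pow_dvd_pow p hm) (ZMod (p ^ m)) := Subsingleton.elim _ _
  exact RingHom.congr_fun hcomp x

omit [Fact p.Prime] in
/-- `levelCast ∘ castHom = castHom` (same reason). [folklore] -/
theorem levelCast_castHom {L m m' : ℕ} (h : m = m') (hm : m ≤ L) (hm' : m' ≤ L) (x : ZMod (p ^ L)) :
    levelCast p h (ZMod.castHom (pow_dvd_pow p hm) (ZMod (p ^ m)) x) =
      ZMod.castHom (pow_dvd_pow p hm') (ZMod (p ^ m')) x := by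
  have hcomp : (levelCast p h).comp (ZMod.castHom (pow_dvd_pow p hm) (ZMod (p ^ m))) =
      ZMod.castHom (pow_dvd_pow p hm') (ZMod (p ^ m')) := Subsingleton.elim _ _
  exact RingHom.congr_fun hcomp x

end Classes

/-! ### Teichmüller representatives and the generator `γ` inside `ℤ_p` -/

section Reps

/-- `μ_τ(ℤ_p)` is finite (Mathlib: `Finite (rootsOfUnity k R)` for `NeZero k`); we fix a `Fintype`
structure once, so that all the finite sums over Teichmüller representatives below use the same
instance. [folklore] -/
instance fintypeRootsOfUnityTorsionOrder : Fintype (rootsOfUnity (torsionOrder p) ℤ_[p]) :=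
  haveI := neZero_torsionOrder p
  Fintype.ofFinite _

/-- The Teichmüller representative `η ∈ μ_τ(ℤ_p)` as an element of `ℤ_p`. [folklore] -/
def teich (η : rootsOfUnity (torsionOrder p) ℤ_[p]) : ℤ_[p] := ((η : ℤ_[p]ˣ) : ℤ_[p])

/-- Unfolding lemma for `teich`. [folklore] -/
theorem teich_def (η : rootsOfUnity (torsionOrder p) ℤ_[p]) : teich η = ((η : ℤ_[p]ˣ) : ℤ_[p]) := rfl

/-- `η^τ = 1`. [folklore] -/
theorem teich_pow_torsionOrder (η : rootsOfUnity (torsionOrder p) ℤ_[p]) :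
    teich η ^ torsionOrder p = 1 :=
  rootsOfUnity_pow_torsionOrder p η

/-- `‖η‖ = 1`. [folklore] -/
theorem norm_teich (η : rootsOfUnity (torsionOrder p) ℤ_[p]) : ‖teich η‖ = 1 :=
  PadicInt.isUnit_iff.mp (Units.isUnit _)

/-- `η^a = 1` for `τ ∣ a`. [folklore] -/
theorem teich_pow_eq_one_of_dvd {a : ℕ} (h : torsionOrder p ∣ a)
    (η : rootsOfUnity (torsionOrder p) ℤ_[p]) : teich η ^ a = 1 := by
  obtain ⟨k, rfl⟩ := h
  rw [pow_mul, teich_pow_torsionOrder, one_pow]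

/-- `η^c = η^b` for `c ≡ b (mod τ)`. [folklore] -/
theorem teich_pow_eq_pow_of_modEq {c b : ℕ} (h : c ≡ b [MOD torsionOrder p])
    (η : rootsOfUnity (torsionOrder p) ℤ_[p]) : teich η ^ c = teich η ^ b := by
  rw [pow_eq_pow_mod c (teich_pow_torsionOrder η), pow_eq_pow_mod b (teich_pow_torsionOrder η),
    show c % torsionOrder p = b % torsionOrder p from h]

/-- **`γ = 1 + p^{e₀}` is a principal unit of `ℤ_p`**: `‖γ − 1‖ = p^{-e₀} < 1`. [folklore] -/
theorem norm_cyclotomicGenerator_sub_one_lt_one :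
    ‖((cyclotomicGenerator p : ℕ) : ℤ_[p]) - 1‖ < 1 := by
  rw [cyclotomicGenerator, Nat.cast_add, Nat.cast_one, Nat.cast_pow, add_sub_cancel_left, norm_pow]
  refine pow_lt_one₀ (norm_nonneg _) ?_ (cyclotomicExponent_ne_zero p)
  rw [PadicInt.norm_p]
  exact inv_lt_one_of_one_lt₀ (by exact_mod_cast (Fact.out : p.Prime).one_lt)

end Reps

/-! ### The class-coordinate pieces of a distribution on `ℤ_p × ℤ_p` -/

namespace BoundedDistribution

section ClassDist

variable {𝕜 : Type*} [NormedField 𝕜] (ν : BoundedDistribution (padicIntSq p) 𝕜)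

/-- The level-`n` class of `(η, s)`, transported to the level `e₀ + n` of the class-coordinate
tower. [folklore] -/
def classOf' (n : ℕ) (η : rootsOfUnity (torsionOrder p) ℤ_[p]) (s : ZMod (p ^ n)) :
    ZMod (p ^ (cyclotomicExponent p + n)) :=
  levelCast p (Nat.add_comm n (cyclotomicExponent p)) (classOf p n η s)

/-- Unfolding lemma for `classOf'`. [folklore] -/
theorem classOf'_def (n : ℕ) (η : rootsOfUnity (torsionOrder p) ℤ_[p]) (s : ZMod (p ^ n)) :
    classOf' (p := p) n η s = levelCast p (Nat.add_comm n (cyclotomicExponent p)) (classOf p n η s) :=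
  rfl

/-- `(η, s) ↦ classOf' n η s` is injective in `s`. [folklore] -/
theorem classOf'_injective (n : ℕ) (η : rootsOfUnity (torsionOrder p) ℤ_[p]) {s s' : ZMod (p ^ n)}
    (h : classOf' (p := p) n η s = classOf' n η s') : s = s' :=
  (classOf_injective n (levelCast_injective _ h)).2

/-- Reduction of `classOf'`: `classOf' (n+1) η s' mod p^{e₀+n} = classOf' n η (s' mod p^n)`.
[folklore] -/
theorem castHom_classOf' (n : ℕ) (η : rootsOfUnity (torsionOrder p) ℤ_[p]) (s' : ZMod (p ^ (n + 1))) :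
    ZMod.castHom (pow_dvd_pow p (Nat.le_succ _)) (ZMod (p ^ (cyclotomicExponent p + n)))
        (classOf' (p := p) (n + 1) η s') =
      classOf' n η (ZMod.castHom (pow_dvd_pow p n.le_succ) (ZMod (p ^ n)) s') := by
  rw [classOf'_def, classOf'_def, ← castHom_classOf n η s',
    castHom_levelCast (Nat.add_comm (n + 1) (cyclotomicExponent p)) (by omega) (by omega),
    levelCast_castHom (Nat.add_comm n (cyclotomicExponent p)) (by omega) (by omega)]

/-- Lifts of `classOf' n η s` to level `e₀ + n + 1` are of the form `classOf' (n+1) η s'`,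
`s' ≡ s (mod p^n)`. [folklore] -/
theorem exists_lift_classOf' (n : ℕ) (η : rootsOfUnity (torsionOrder p) ℤ_[p]) (s : ZMod (p ^ n))
    {c : ZMod (p ^ (cyclotomicExponent p + n + 1))}
    (hc : ZMod.castHom (pow_dvd_pow p (Nat.le_succ _)) (ZMod (p ^ (cyclotomicExponent p + n))) c =
      classOf' (p := p) n η s) :
    ∃ s' : ZMod (p ^ (n + 1)), ZMod.castHom (pow_dvd_pow p n.le_succ) (ZMod (p ^ n)) s' = s ∧
      classOf' (n + 1) η s' = c := by
  have hL : n + 1 + cyclotomicExponent p = cyclotomicExponent p + n + 1 := by omega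
  -- transport `c` to the level `n + 1 + e₀` of `classOf`
  set c₀ : ZMod (p ^ (n + 1 + cyclotomicExponent p)) := levelCast p hL.symm c with hc₀
  have hc' : ZMod.castHom (pow_dvd_pow p (by omega : n + cyclotomicExponent p ≤ n + 1 + cyclotomicExponent p))
      (ZMod (p ^ (n + cyclotomicExponent p))) c₀ = classOf p n η s := by
    apply levelCast_injective (Nat.add_comm n (cyclotomicExponent p))
    rw [← classOf'_def, ← hc, hc₀, castHom_levelCast hL.symm (by omega) (by omega),
      levelCast_castHom (Nat.add_comm n (cyclotomicExponent p)) (by omega) (by omega)]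
  obtain ⟨s', hs, hs'⟩ := exists_lift_classOf n η s hc'
  refine ⟨s', hs, ?_⟩
  rw [classOf'_def, hs', hc₀, levelCast_levelCast]
  exact levelCast_rfl c

/-- **The class-coordinate piece `ν^{(η₁, η₂)}` of a bounded distribution `ν` on `ℤ_p × ℤ_p`**: the
bounded distribution on `ℤ_p × ℤ_p` (log-coordinates `(s, t)`, levels `e₀ + n`) with level-`n` data
`(s, t) ↦ ν_{e₀+n}(η₁ γ^s, η₂ γ^t)` — the restriction of `ν` to `ℤ_p^× × ℤ_p^×` read in the
Teichmüller–`γ` coordinates `(x, z) = (η₁ γ^σ, η₂ γ^τ)` (Washington §7.2; Mazur–Tate–Teitelbaum 1986,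
§I.13).  The distribution relation is `exists_lift_classOf'`. [cite: MazurTateTeitelbaum1986Invent, §I.13] -/
def classDist (η₁ η₂ : rootsOfUnity (torsionOrder p) ℤ_[p]) : BoundedDistribution (padicIntSq p) 𝕜 where
  μ n st := ν.μ (cyclotomicExponent p + n) (classOf' n η₁ st.1, classOf' n η₂ st.2)
  sum_fiber n a := by
    classical
    obtain ⟨a₁, a₂⟩ := a
    -- both sides live on the level `e₀ + n + 1` of `ν`
    rw [← ν.sum_fiber (cyclotomicExponent p + n) (classOf' n η₁ a₁, classOf' n η₂ a₂)]
    refine Finset.sum_bij (fun b _ => (classOf' (n + 1) η₁ b.1, classOf' (n + 1) η₂ b.2))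
      (fun b hb => ?_) (fun b₁ hb₁ b₂ hb₂ h => ?_) (fun c hc => ?_) (fun b hb => rfl)
    · -- maps the fiber into the fiber
      simp only [Finset.mem_filter, Finset.mem_univ, true_and, ProfiniteTower.prod_trans,
        ProfiniteTower.padicInt_trans] at hb ⊢
      have hb' := Prod.mk.inj hb
      rw [castHom_classOf', castHom_classOf', hb'.1, hb'.2]
    · -- injective
      obtain ⟨h1, h2⟩ := Prod.mk.inj h
      exact Prod.ext (classOf'_injective _ _ h1) (classOf'_injective _ _ h2)
    · -- surjective onto the fiber
      simp only [Finset.mem_filter, Finset.mem_univ, true_and, ProfiniteTower.prod_trans,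
        ProfiniteTower.padicInt_trans] at hc
      have hc' := Prod.mk.inj hc
      obtain ⟨s', hs, hs'⟩ := exists_lift_classOf' n η₁ a₁ hc'.1
      obtain ⟨t', ht, ht'⟩ := exists_lift_classOf' n η₂ a₂ hc'.2
      refine ⟨(s', t'), ?_, ?_⟩
      · simp only [Finset.mem_filter, Finset.mem_univ, true_and, ProfiniteTower.prod_trans,
          ProfiniteTower.padicInt_trans, hs, ht]
      · rw [hs', ht']; rfl
  bound := ν.bound
  bound_nonneg := ν.bound_nonneg
  norm_le n st := ν.norm_le _ _

/-- The level data of the class-coordinate piece. [folklore] -/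
@[simp] theorem classDist_μ (η₁ η₂ : rootsOfUnity (torsionOrder p) ℤ_[p]) (n : ℕ)
    (st : ZMod (p ^ n) × ZMod (p ^ n)) :
    (ν.classDist η₁ η₂).μ n st = ν.μ (cyclotomicExponent p + n) (classOf' n η₁ st.1, classOf' n η₂ st.2) :=
  rfl

/-- The bound of the class-coordinate piece is that of `ν`. [folklore] -/
@[simp] theorem classDist_bound (η₁ η₂ : rootsOfUnity (torsionOrder p) ℤ_[p]) :
    (ν.classDist η₁ η₂).bound = ν.bound := rfl

end ClassDist

/-! ### Class representatives in `ℤ_p` and the branch series -/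

section Branch

/-- `(η, s) ↦ classOf' n η s` is injective (jointly in `η` and `s`). [folklore] -/
theorem classOf'_inj (n : ℕ) {η η' : rootsOfUnity (torsionOrder p) ℤ_[p]} {s s' : ZMod (p ^ n)}
    (h : classOf' (p := p) n η s = classOf' n η' s') : η = η' ∧ s = s' :=
  classOf_injective n (levelCast_injective _ h)

/-- **Every pair of units of `ℤ/p^{e₀+n}` is a pair of classes.** [folklore] -/
theorem exists_classOf'_eq_of_isUnit (n : ℕ) {b : ZMod (p ^ (cyclotomicExponent p + n))}
    (hb : IsUnit b) : ∃ (η : rootsOfUnity (torsionOrder p) ℤ_[p]) (s : ZMod (p ^ n)),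
      classOf' n η s = b := by
  have hb' : IsUnit (levelCast p (Nat.add_comm (cyclotomicExponent p) n) b) := hb.map _
  obtain ⟨η, s, hs⟩ := exists_classOf_eq_of_isUnit n hb'
  refine ⟨η, s, ?_⟩
  rw [classOf'_def, hs, levelCast_symm_levelCast]

/-- The **representative `η γ^{s.val} ∈ ℤ_p^×`** of the class `classOf' n η s`. [folklore] -/
def classRep (n : ℕ) (η : rootsOfUnity (torsionOrder p) ℤ_[p]) (s : ZMod (p ^ n)) : ℤ_[p] :=
  teich η * ((cyclotomicGenerator p : ℕ) : ℤ_[p]) ^ s.val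

/-- Unfolding lemma for `classRep`. [folklore] -/
theorem classRep_def (n : ℕ) (η : rootsOfUnity (torsionOrder p) ℤ_[p]) (s : ZMod (p ^ n)) :
    classRep n η s = teich η * ((cyclotomicGenerator p : ℕ) : ℤ_[p]) ^ s.val := rfl

/-- `classRep n η s` reduces to `classOf' n η s` modulo `p^{e₀+n}`. [folklore] -/
theorem toZModPow_classRep (n : ℕ) (η : rootsOfUnity (torsionOrder p) ℤ_[p]) (s : ZMod (p ^ n)) :
    PadicInt.toZModPow (cyclotomicExponent p + n) (classRep n η s) = classOf' (p := p) n η s := by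
  rw [classRep_def, classOf'_def, classOf_def, map_mul, map_pow, map_natCast, map_mul, map_pow,
    map_natCast, levelCast, ZMod.castHom_apply,
    PadicInt.cast_toZModPow _ _ (le_of_eq (Nat.add_comm _ _)), teich_def]

/-- **The monomial `ω^c(x) ⟨z⟩^a ⟨x⟩^b` on the class `(η₁ γ^s, η₂ γ^t)` is `z^a x^b` at the
representatives**, for `τ ∣ a` and `c ≡ b (mod τ)`:
`η₂^c · γ^{a s} γ^{b t} = (η₁ γ^s)^a (η₂ γ^t)^b`. [folklore] -/
theorem teich_pow_mul_pow_mul_pow_eq {a b c : ℕ} (hτa : torsionOrder p ∣ a)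
    (hcb : c ≡ b [MOD torsionOrder p]) (n : ℕ) (η₁ η₂ : rootsOfUnity (torsionOrder p) ℤ_[p])
    (s t : ZMod (p ^ n)) :
    ((teich η₂ : ℤ_[p]) : ℚ_[p]) ^ c *
        ((cyclotomicGenerator p : ℚ_[p]) ^ (a * s.val) * (cyclotomicGenerator p : ℚ_[p]) ^ (b * t.val)) =
      ((classRep n η₁ s : ℤ_[p]) : ℚ_[p]) ^ a * ((classRep n η₂ t : ℤ_[p]) : ℚ_[p]) ^ b := by
  have h1 : ((teich η₁ : ℤ_[p]) : ℚ_[p]) ^ a = 1 := by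
    rw [← PadicInt.coe_pow, teich_pow_eq_one_of_dvd hτa, PadicInt.coe_one]
  have h2 : ((teich η₂ : ℤ_[p]) : ℚ_[p]) ^ c = ((teich η₂ : ℤ_[p]) : ℚ_[p]) ^ b := by
    rw [← PadicInt.coe_pow, teich_pow_eq_pow_of_modEq hcb, PadicInt.coe_pow]
  simp only [classRep_def, PadicInt.coe_mul, PadicInt.coe_pow, PadicInt.coe_natCast, mul_pow, ← pow_mul,
    h1, h2, one_mul]
  rw [mul_comm s.val a, mul_comm t.val b]
  ring

variable (ν : BoundedDistribution (padicIntSq p) ℚ_[p])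

/-- **The `ω^c`-branch series** of a bounded distribution `ν` on `ℤ_p × ℤ_p` (thought of as
supported on `ℤ_p^× × ℤ_p^×`):
`branchSeries ν c = Σ_{(η₁, η₂)} η₂^c · 𝓐(classDist ν η₁ η₂) ∈ ℚ_p⟦X, Y⟧`, i.e.
`F_c(X, Y) = "∫ ω^c(x) (1+X)^{ℓ(z)} (1+Y)^{ℓ(x)} dν(z, x)"` with `ℓ(η γ^σ) = σ`
(Delbourgo 2008, Def. 4.12 with `ψ = ω^{-c}`, in the coordinates `(z, x) = (y/x, x)`).
[cite: Delbourgo2008, Def. 4.12] -/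
def branchSeries (c : ℕ) : MvPowerSeries (Fin 2) ℚ_[p] :=
  transformSum
    (fun ηη : rootsOfUnity (torsionOrder p) ℤ_[p] × rootsOfUnity (torsionOrder p) ℤ_[p] =>
      ν.classDist ηη.1 ηη.2)
    (fun ηη => ((teich ηη.2 : ℤ_[p]) : ℚ_[p]) ^ c)

/-- Unfolding lemma for `branchSeries`. [folklore] -/
theorem branchSeries_def (c : ℕ) : ν.branchSeries c = transformSum
    (fun ηη : rootsOfUnity (torsionOrder p) ℤ_[p] × rootsOfUnity (torsionOrder p) ℤ_[p] =>
      ν.classDist ηη.1 ηη.2)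
    (fun ηη => ((teich ηη.2 : ℤ_[p]) : ℚ_[p]) ^ c) := rfl

/-- The weights `η₂^c` have norm `≤ 1`. [folklore] -/
theorem norm_teich_coe_pow_le_one (η : rootsOfUnity (torsionOrder p) ℤ_[p]) (c : ℕ) :
    ‖((teich η : ℤ_[p]) : ℚ_[p]) ^ c‖ ≤ 1 := by
  rw [norm_pow, PadicInt.padic_norm_e_of_padicInt, norm_teich, one_pow]

/-- **Integrality of the branch series** for `‖ν‖ ≤ 1`. [folklore] -/
theorem isPadicInt_branchSeries (hν : ν.bound ≤ 1) (c : ℕ) : IsPadicInt (ν.branchSeries c) :=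
  isPadicInt_transformSum _ _ (fun _ => by simpa only [classDist_bound] using hν)
    fun ηη => norm_teich_coe_pow_le_one ηη.2 c

/-- **The values `F_c(γ^a − 1, γ^b − 1)` in class coordinates**: they are the limits of
`Σ_{η₁,η₂} η₂^c Σ_{s,t mod p^n} ν_{e₀+n}(η₁γ^s, η₂γ^t) γ^{a s} γ^{b t}`
(Mazur–Tate–Teitelbaum 1986, §I.13, two variables, all branches).
[cite: MazurTateTeitelbaum1986Invent, §I.13] -/
theorem tendsto_branchSeries (hν : ν.bound ≤ 1) (a b c : ℕ) :
    Tendsto (fun n : ℕ => ∑ ηη : rootsOfUnity (torsionOrder p) ℤ_[p] × rootsOfUnity (torsionOrder p) ℤ_[p],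
        ((teich ηη.2 : ℤ_[p]) : ℚ_[p]) ^ c * ∑ st : ZMod (p ^ n) × ZMod (p ^ n),
          ν.μ (cyclotomicExponent p + n) (classOf' n ηη.1 st.1, classOf' n ηη.2 st.2) *
            ((cyclotomicGenerator p : ℚ_[p]) ^ (a * st.1.val) *
              (cyclotomicGenerator p : ℚ_[p]) ^ (b * st.2.val)))
      atTop (𝓝 (padicEval₂ (ν.branchSeries c) ((cyclotomicGenerator p : ℚ_[p]) ^ a - 1)
        ((cyclotomicGenerator p : ℚ_[p]) ^ b - 1))) := by
  have h := tendsto_sum_mul_sum_mul_pow_padicEval₂_transformSum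
    (fun ηη : rootsOfUnity (torsionOrder p) ℤ_[p] × rootsOfUnity (torsionOrder p) ℤ_[p] =>
      ν.classDist ηη.1 ηη.2)
    (fun ηη => ((teich ηη.2 : ℤ_[p]) : ℚ_[p]) ^ c)
    (fun _ => by simpa only [classDist_bound] using hν) (fun ηη => norm_teich_coe_pow_le_one ηη.2 c)
    (norm_cyclotomicGenerator_sub_one_lt_one (p := p)) a b
  simpa only [classDist_μ, PadicInt.coe_natCast, branchSeries_def] using h

/-- The **level-`n` sum of `f` over the unit classes with the representatives `η γ^{s.val}`**:
`Σ_{η₁,η₂} Σ_{s,t mod p^n} ν_{e₀+n}(η₁γ^s, η₂γ^t) · f(η₁γ^s, η₂γ^t)`. [folklore] -/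
def classRepSum (f : ℤ_[p] × ℤ_[p] → ℚ_[p]) (n : ℕ) : ℚ_[p] :=
  ∑ ηη : rootsOfUnity (torsionOrder p) ℤ_[p] × rootsOfUnity (torsionOrder p) ℤ_[p],
    ∑ st : ZMod (p ^ n) × ZMod (p ^ n),
      ν.μ (cyclotomicExponent p + n) (classOf' n ηη.1 st.1, classOf' n ηη.2 st.2) *
        f (classRep n ηη.1 st.1, classRep n ηη.2 st.2)

/-- Unfolding lemma for `classRepSum`. [folklore] -/
theorem classRepSum_def (f : ℤ_[p] × ℤ_[p] → ℚ_[p]) (n : ℕ) : ν.classRepSum f n =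
    ∑ ηη : rootsOfUnity (torsionOrder p) ℤ_[p] × rootsOfUnity (torsionOrder p) ℤ_[p],
      ∑ st : ZMod (p ^ n) × ZMod (p ^ n),
        ν.μ (cyclotomicExponent p + n) (classOf' n ηη.1 st.1, classOf' n ηη.2 st.2) *
          f (classRep n ηη.1 st.1, classRep n ηη.2 st.2) := rfl

/-- **The values `F_c(γ^a − 1, γ^b − 1)` in unit coordinates** for `τ ∣ a`, `c ≡ b (mod τ)`:
they are the limits of `Σ ν_{e₀+n}(η₁γ^s, η₂γ^t) · (η₁γ^s)^a (η₂γ^t)^b`, i.e. of the Riemann sums of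
`z^a x^b` over `((ℤ/p^{e₀+n})^×)²` with the representatives `η γ^{s.val}`. [folklore] -/
theorem tendsto_classRepSum_pow_branchSeries (hν : ν.bound ≤ 1) {a b c : ℕ}
    (hτa : torsionOrder p ∣ a) (hcb : c ≡ b [MOD torsionOrder p]) :
    Tendsto (ν.classRepSum fun zx => (zx.1 : ℚ_[p]) ^ a * (zx.2 : ℚ_[p]) ^ b)
      atTop (𝓝 (padicEval₂ (ν.branchSeries c) ((cyclotomicGenerator p : ℚ_[p]) ^ a - 1)
        ((cyclotomicGenerator p : ℚ_[p]) ^ b - 1))) := by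
  refine (ν.tendsto_branchSeries hν a b c).congr fun n => ?_
  rw [classRepSum_def]
  refine Finset.sum_congr rfl fun ηη _ => ?_
  rw [Finset.mul_sum]
  refine Finset.sum_congr rfl fun st _ => ?_
  rw [mul_left_comm, teich_pow_mul_pow_mul_pow_eq hτa hcb n ηη.1 ηη.2 st.1 st.2]

end Branch

/-! ### From unit-class sums to the integral over `ℤ_p × ℤ_p` -/

section Integral

variable (ν : BoundedDistribution (padicIntSq p) ℚ_[p])

/-- **The Riemann sums of a distribution supported on `ℤ_p^× × ℤ_p^×`, reindexed by classes**: at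
level `e₀ + n` the cells off `((ℤ/p^{e₀+n})^×)²` carry no mass, and the unit cells are the classes
`(η₁γ^s, η₂γ^t)` exactly once (`classOf'_inj`, `exists_classOf'_eq_of_isUnit`). [folklore] -/
theorem riemannSum_eq_sum_classes
    (hsupp : ∀ (L : ℕ) (c : ZMod (p ^ L) × ZMod (p ^ L)), 1 ≤ L → ¬ (IsUnit c.1 ∧ IsUnit c.2) →
      ν.μ L c = 0)
    (f : ℤ_[p] × ℤ_[p] → ℚ_[p]) (n : ℕ) :
    ν.riemannSum f (cyclotomicExponent p + n) =
      ∑ ηη : rootsOfUnity (torsionOrder p) ℤ_[p] × rootsOfUnity (torsionOrder p) ℤ_[p],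
        ∑ st : ZMod (p ^ n) × ZMod (p ^ n),
          ν.μ (cyclotomicExponent p + n) (classOf' n ηη.1 st.1, classOf' n ηη.2 st.2) *
            f ((padicIntSq p).repr (cyclotomicExponent p + n)
              (classOf' n ηη.1 st.1, classOf' n ηη.2 st.2)) := by
  classical
  let Ψ : (rootsOfUnity (torsionOrder p) ℤ_[p] × rootsOfUnity (torsionOrder p) ℤ_[p]) ×
      (ZMod (p ^ n) × ZMod (p ^ n)) →
      ZMod (p ^ (cyclotomicExponent p + n)) × ZMod (p ^ (cyclotomicExponent p + n)) :=
    fun q => (classOf' n q.1.1 q.2.1, classOf' n q.1.2 q.2.2)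
  have hΨ : Function.Injective Ψ := by
    rintro ⟨⟨η₁, η₂⟩, s, t⟩ ⟨⟨η₁', η₂'⟩, s', t'⟩ h
    obtain ⟨h1, h2⟩ := Prod.mk.inj h
    obtain ⟨rfl, rfl⟩ := classOf'_inj n h1
    obtain ⟨rfl, rfl⟩ := classOf'_inj n h2
    rfl
  let g : ZMod (p ^ (cyclotomicExponent p + n)) × ZMod (p ^ (cyclotomicExponent p + n)) → ℚ_[p] :=
    fun c => ν.μ (cyclotomicExponent p + n) c *
      f ((padicIntSq p).repr (cyclotomicExponent p + n) c)
  have h1 : ν.riemannSum f (cyclotomicExponent p + n) = ∑ c, g c := rfl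
  have h2 : ∑ c, g c = ∑ c ∈ Finset.univ.image Ψ, g c := by
    refine (Finset.sum_subset (Finset.subset_univ _) fun c _ hc => ?_).symm
    have hcu : ¬ (IsUnit c.1 ∧ IsUnit c.2) := by
      rintro ⟨hu1, hu2⟩
      obtain ⟨η₁, s, hs⟩ := exists_classOf'_eq_of_isUnit n hu1
      obtain ⟨η₂, t, ht⟩ := exists_classOf'_eq_of_isUnit n hu2
      exact hc (Finset.mem_image.mpr ⟨((η₁, η₂), (s, t)), Finset.mem_univ _, Prod.ext hs ht⟩)
    show ν.μ _ c * _ = 0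
    rw [hsupp _ c (by have := cyclotomicExponent_ne_zero p; omega) hcu, zero_mul]
  have h3 : ∑ c ∈ Finset.univ.image Ψ, g c = ∑ q, g (Ψ q) := Finset.sum_image fun x _ y _ h => hΨ h
  rw [h1, h2, h3, Fintype.sum_prod_type]
  rfl

/-- **The unit-class sums approximate the Riemann sums**: if `f` varies by at most `δ` on the
level-`(e₀ + n)` cells, then `‖classRepSum f n − RS f (e₀ + n)‖ ≤ ‖ν‖ · δ` (the two sums differ only
in the choice of representatives of the unit cells). [folklore] -/
theorem norm_classRepSum_sub_riemannSum_le
    (hsupp : ∀ (L : ℕ) (c : ZMod (p ^ L) × ZMod (p ^ L)), 1 ≤ L → ¬ (IsUnit c.1 ∧ IsUnit c.2) →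
      ν.μ L c = 0)
    {f : ℤ_[p] × ℤ_[p] → ℚ_[p]} {δ : ℝ} (hδ : 0 ≤ δ) {n : ℕ}
    (hf : ∀ x y, (padicIntSq p).proj (cyclotomicExponent p + n) x =
      (padicIntSq p).proj (cyclotomicExponent p + n) y → ‖f x - f y‖ ≤ δ) :
    ‖ν.classRepSum f n - ν.riemannSum f (cyclotomicExponent p + n)‖ ≤ ν.bound * δ := by
  rw [ν.riemannSum_eq_sum_classes hsupp f n, classRepSum_def, ← Finset.sum_sub_distrib]
  refine IsUltrametricDist.norm_sum_le_of_forall_le_of_nonneg (mul_nonneg ν.bound_nonneg hδ)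
    fun ηη _ => ?_
  rw [← Finset.sum_sub_distrib]
  refine IsUltrametricDist.norm_sum_le_of_forall_le_of_nonneg (mul_nonneg ν.bound_nonneg hδ)
    fun st _ => ?_
  rw [← mul_sub, norm_mul]
  refine mul_le_mul (ν.norm_le _ _) (hf _ _ ?_) (norm_nonneg _) ν.bound_nonneg
  rw [ProfiniteTower.proj_repr, ProfiniteTower.prod_proj, ProfiniteTower.padicInt_proj,
    ProfiniteTower.padicInt_proj, toZModPow_classRep, toZModPow_classRep]

/-- **The unit-class sums converge to the integral**: for `ν` supported on `ℤ_p^× × ℤ_p^×` and `f`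
uniformly continuous, `classRepSum f n → ∫ f dν` (`PAdicDistributionIntegral.integral`). [folklore] -/
theorem tendsto_classRepSum_integral
    (hsupp : ∀ (L : ℕ) (c : ZMod (p ^ L) × ZMod (p ^ L)), 1 ≤ L → ¬ (IsUnit c.1 ∧ IsUnit c.2) →
      ν.μ L c = 0)
    {f : ℤ_[p] × ℤ_[p] → ℚ_[p]} (hf : UniformContinuous f) :
    Tendsto (ν.classRepSum f) atTop (𝓝 (ν.integral f)) := by
  have hsub : Tendsto (fun n : ℕ => cyclotomicExponent p + n) atTop atTop :=
    tendsto_atTop_atTop.mpr fun b => ⟨b, fun n hn => hn.trans (Nat.le_add_left n _)⟩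
  have hRS : Tendsto (fun n => ν.riemannSum f (cyclotomicExponent p + n)) atTop (𝓝 (ν.integral f)) :=
    (ν.tendsto_riemannSum_integral hf).comp hsub
  have h0 : Tendsto (fun n => ν.classRepSum f n - ν.riemannSum f (cyclotomicExponent p + n))
      atTop (𝓝 0) := by
    refine Metric.tendsto_atTop.mpr fun ε hε => ?_
    have hb : 0 < ν.bound + 1 := by linarith [ν.bound_nonneg]
    obtain ⟨N, hN⟩ := (padicIntSq p).exists_forall_norm_sub_le hf (div_pos hε hb)
    refine ⟨N, fun n hn => ?_⟩
    rw [dist_zero_right]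
    calc ‖ν.classRepSum f n - ν.riemannSum f (cyclotomicExponent p + n)‖
        ≤ ν.bound * (ε / (ν.bound + 1)) := ν.norm_classRepSum_sub_riemannSum_le hsupp
          (div_pos hε hb).le (hN _ (hn.trans (Nat.le_add_left n _)))
      _ < ε := by
          rw [mul_div_assoc', div_lt_iff₀ hb]
          nlinarith [ν.bound_nonneg]
  have h := h0.add hRS
  simpa only [sub_add_cancel, zero_add] using h

/-- Monomials are uniformly continuous on `ℤ_p × ℤ_p`. [folklore] -/
theorem uniformContinuous_monomial (a b : ℕ) :
    UniformContinuous fun zx : ℤ_[p] × ℤ_[p] => (zx.1 : ℚ_[p]) ^ a * (zx.2 : ℚ_[p]) ^ b :=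
  CompactSpace.uniformContinuous_of_continuous (by fun_prop)

/-- **The branch series computes the moments of `ν` on `ℤ_p^× × ℤ_p^×`**: for a distribution `ν` on
`ℤ_p × ℤ_p` with `‖ν‖ ≤ 1` supported on pairs of units, `τ ∣ a` and `c ≡ b (mod τ)`,

  `F_c(γ^a − 1, γ^b − 1) = ∫_{ℤ_p × ℤ_p} z^a x^b dν(z, x)`,

i.e. `∫ ω^c(x) ⟨z⟩^a ⟨x⟩^b dν = ∫ z^a x^b dν` read through the Amice transform — the identity behind
the interpolation formula of the two-variable `p`-adic `L`-function at `(k, n)` with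
`a = k − 2 ≡ 0 (mod p − 1)`, `b = n − 1`, `c ≡ n − 1` (Delbourgo 2008, Thm. 4.11 & p. 100;
Mazur–Tate–Teitelbaum 1986, §I.13). [cite: Delbourgo2008, Thm. 4.11] -/
theorem padicEval₂_branchSeries_eq_integral (hν : ν.bound ≤ 1)
    (hsupp : ∀ (L : ℕ) (c : ZMod (p ^ L) × ZMod (p ^ L)), 1 ≤ L → ¬ (IsUnit c.1 ∧ IsUnit c.2) →
      ν.μ L c = 0)
    {a b c : ℕ} (hτa : torsionOrder p ∣ a) (hcb : c ≡ b [MOD torsionOrder p]) :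
    padicEval₂ (ν.branchSeries c) ((cyclotomicGenerator p : ℚ_[p]) ^ a - 1)
        ((cyclotomicGenerator p : ℚ_[p]) ^ b - 1) =
      ν.integral fun zx => (zx.1 : ℚ_[p]) ^ a * (zx.2 : ℚ_[p]) ^ b :=
  tendsto_nhds_unique (ν.tendsto_classRepSum_pow_branchSeries hν hτa hcb)
    (ν.tendsto_classRepSum_integral hsupp (uniformContinuous_monomial a b))

end Integral

end BoundedDistribution

end Literature.NumberTheory.EllipticCurves

end
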